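import Literature.Geometry.Lorentzian.Basic
import Literature.Geometry.Lorentzian.CoordCurvature
import HarnessLib

/-!
# Crux `GapExhaustion` (stmt-FinalStateConjecture-10808), line `photon-shell-pseudoconvexity`:
# stub (K-A4) `stub_killingProlongation_of` — the prolongation of the Killing equation

Route `BartnikGapSettling`; helper (`--supports stmt-FinalStateConjecture-10808`) landing the
registered sub-stub (K-A4) of line lead c8, wave 2 (LOCAL unique continuation of coordinate
Killing vector fields from a `1`-jet, the patching tool of the Ionescu–Klainerman sweeps): the
classical prolongation of the Killing equation, `(∇_X ∇K)(Y) = R(X, K)Y` (O'Neill 1983, Ch. 9,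
Exercise 8: `D_V(DK) = R_{KV}` for `K` Killing, with O'Neill's `R_{KV} = −R(K,V) = R(V,K)` in the
convention of `Literature.Geometry.Lorentzian.MetricCoord.riemAt`; it is the identity behind
O'Neill's Lemma 9.27, a Killing field being determined by its `1`-jet at a point), in the tree's
coordinate vocabulary. For the metric components `G` on the open set `V ⊆ E4` (`IsMetricOn G V`),
a `C²` map `K : E4 → E4` solving the coordinate Killing equation
`DG(x)(K x)(Y, Z) + G x (DK(x) Y) Z + G x Y (DK(x) Z) = 0` on `V`, and `A_x Y := DK(x) Y + Γ_x(Y, K x)`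
(`= ∇_Y K`), one has
`∂_X (A · Y)(x) = R_x(X, K x) Y − Γ_x(X, A_x Y) + A_x(Γ_x(X, Y))` on `V`.

The statement is in implication form, conditional on its three inputs (the other registered
stubs of the wave), and the proof is pure glue. Writing
`B(X,Y,Z) := G x (∂_X(A · Y) + Γ(X, A Y) − A(Γ(X,Y))) Z` (`= G((∇_X ∇K)Y, Z)`):

* (K-A1) `B(X,Y,Z) + B(X,Z,Y) = 0` (differentiated skew-adjointness of `∇K`);
* (K-A2) `B(X,Y,Z) − B(Y,X,Z) = G(R(X,Y)K, Z)` (the Ricci identity);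
* (K-A3) pure algebra: a trilinear `B` skew in its last two slots whose alternation in the first
  two slots is `Rm(X,Y,k,Z)` for a curvature-like `Rm` equals `Rm(X,k,Y,Z)`.

Given these, feed (K-A3) with `Rm(X,Y,Z,W) := G x (R_x(X,Y)Z) W`, whose four symmetries are
`riemAt_swap`, `IsMetricOn.apply_riemAt_swap`, `IsMetricOn.apply_riemAt_cyclic`,
`IsMetricOn.apply_riemAt_pair_comm` (O'Neill 1983, Ch. 3, Prop. 3.36), and with `k := K x`, to get
`B(X,Y,Z) = G(R(X, K x)Y, Z)` for all `Z`; strip `Z` by the injectivity of the invertible map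
`G x : E4 → E4*` and rearrange.
-/

noncomputable section

-- instance search through the nested operator types `E4 →L[ℝ] E4 →L[ℝ] E4 →L[ℝ] ℝ`
set_option maxSynthPendingDepth 3

-- D-0017: single-problem summit, `Summit.<S>.<S>.…` by design (cf. lakefile `weak.linter.dupNamespace`).
set_option linter.dupNamespace false

namespace Summit.FinalStateConjecture.FinalStateConjecture.Theorems

open Set Filter Literature.Geometry.Lorentzian Literature.Geometry.Lorentzian.MetricCoord
open scoped Topology

/-- Nondegeneracy strips the test vector: if `G x` is invertible (as a map `E4 → E4*`) and
`G x v Z = G x w Z` for all `Z`, then `v = w`. [folklore] -/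
private theorem killingProlongationOf_eq_of_forall_apply {G : E4 → E4 →L[ℝ] E4 →L[ℝ] ℝ} {x : E4}
    (hGx : (G x).IsInvertible) {v w : E4} (h : ∀ Z : E4, G x v Z = G x w Z) : v = w :=
  hGx.injective (ContinuousLinearMap.ext h)

/-- Skew-symmetry of the paired curvature endomorphism in its first two slots:
`G(R(Y,X)Z, W) = −G(R(X,Y)Z, W)` (O'Neill 1983, Ch. 3, Prop. 3.36 (1)). [folklore] -/
private theorem killingProlongationOf_apply_riemAt_swap₁₂ (G : E4 → E4 →L[ℝ] E4 →L[ℝ] ℝ)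
    (x X Y Z W : E4) : G x (riemAt G x Y X Z) W = -G x (riemAt G x X Y Z) W := by
  rw [riemAt_swap G x X Y, _root_.neg_apply, map_neg, _root_.neg_apply]

/-- **(K-A4) The prolongation of the Killing equation** (O'Neill 1983, Ch. 9, Exercise 8,
`D_V(DK) = R_{KV}`, in coordinates and in the convention `R(X,Y) = [∇_X, ∇_Y] − ∇_{[X,Y]}` of
`riemAt`), conditional on (K-A1), (K-A2), (K-A3): for a `C²` solution `K` of the coordinate Killing
equation of the metric components `G` on the open set `V`, with `A_x Y := DK(x) Y + Γ_x(Y, K x)`,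
`∂_X (A · Y)(x) = R_x(X, K x) Y − Γ_x(X, A_x Y) + A_x(Γ_x(X, Y))` at every `x ∈ V`, i.e.
`(∇_X ∇K)(Y) = R(X, K)Y`. [cite: ONeill1983, Ch. 9, Exercise 8] -/
theorem stub_killingProlongation_of :
    (∀ (G : E4 → E4 →L[ℝ] E4 →L[ℝ] ℝ) (V : Set E4) (K : E4 → E4),
      IsMetricOn G V → ContDiffOn ℝ 2 K V →
      (∀ x ∈ V, ∀ Y Z : E4,
        fderiv ℝ G x (K x) Y Z + G x (fderiv ℝ K x Y) Z + G x Y (fderiv ℝ K x Z) = 0) →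
      ∀ x ∈ V, ∀ X Y Z : E4,
        G x (fderiv ℝ (fun y => fderiv ℝ K y Y + chrAt G y Y (K y)) x X
            + chrAt G x X (fderiv ℝ K x Y + chrAt G x Y (K x))
            - (fderiv ℝ K x (chrAt G x X Y) + chrAt G x (chrAt G x X Y) (K x))) Z
        + G x (fderiv ℝ (fun y => fderiv ℝ K y Z + chrAt G y Z (K y)) x X
            + chrAt G x X (fderiv ℝ K x Z + chrAt G x Z (K x))
            - (fderiv ℝ K x (chrAt G x X Z) + chrAt G x (chrAt G x X Z) (K x))) Y = 0) →
    (∀ (G : E4 → E4 →L[ℝ] E4 →L[ℝ] ℝ) (V : Set E4) (K : E4 → E4),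
      IsMetricOn G V → ContDiffOn ℝ 2 K V →
      ∀ x ∈ V, ∀ X Y Z : E4,
        G x (fderiv ℝ (fun y => fderiv ℝ K y Y + chrAt G y Y (K y)) x X
            + chrAt G x X (fderiv ℝ K x Y + chrAt G x Y (K x))
            - (fderiv ℝ K x (chrAt G x X Y) + chrAt G x (chrAt G x X Y) (K x))) Z
        - G x (fderiv ℝ (fun y => fderiv ℝ K y X + chrAt G y X (K y)) x Y
            + chrAt G x Y (fderiv ℝ K x X + chrAt G x X (K x))
            - (fderiv ℝ K x (chrAt G x Y X) + chrAt G x (chrAt G x Y X) (K x))) Z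
        = G x (riemAt G x X Y (K x)) Z) →
    (∀ (Rm : E4 → E4 → E4 → E4 → ℝ) (B : E4 → E4 → E4 → ℝ) (k : E4),
      (∀ X Y Z W : E4, Rm Y X Z W = -Rm X Y Z W) →
      (∀ X Y Z W : E4, Rm X Y W Z = -Rm X Y Z W) →
      (∀ X Y Z W : E4, Rm X Y Z W + Rm Y Z X W + Rm Z X Y W = 0) →
      (∀ X Y Z W : E4, Rm X Y Z W = Rm Z W X Y) →
      (∀ X Y Z : E4, B X Z Y = -B X Y Z) →
      (∀ X Y Z : E4, B X Y Z - B Y X Z = Rm X Y k Z) →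
      ∀ X Y Z : E4, B X Y Z = Rm X k Y Z) →
    ∀ (G : E4 → E4 →L[ℝ] E4 →L[ℝ] ℝ) (V : Set E4) (K : E4 → E4),
      IsMetricOn G V → ContDiffOn ℝ 2 K V →
      (∀ x ∈ V, ∀ Y Z : E4,
        fderiv ℝ G x (K x) Y Z + G x (fderiv ℝ K x Y) Z + G x Y (fderiv ℝ K x Z) = 0) →
      ∀ x ∈ V, ∀ X Y : E4,
        fderiv ℝ (fun y => fderiv ℝ K y Y + chrAt G y Y (K y)) x X =
          riemAt G x X (K x) Y - chrAt G x X (fderiv ℝ K x Y + chrAt G x Y (K x))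
            + (fderiv ℝ K x (chrAt G x X Y) + chrAt G x (chrAt G x X Y) (K x)) := by
  intro hA1 hA2 hA3 G V K hG hK hKil x hx X Y
  -- (K-A3) at the point `x`, with `Rm(X,Y,Z,W) := G(R(X,Y)Z, W)`, `B` as in the docstring and
  -- `k := K x`: `B(X,Y,Z) = G(R(X, K x)Y, Z)` for all `X Y Z`
  have key : ∀ X Y Z : E4,
      G x (fderiv ℝ (fun y => fderiv ℝ K y Y + chrAt G y Y (K y)) x X
          + chrAt G x X (fderiv ℝ K x Y + chrAt G x Y (K x))
          - (fderiv ℝ K x (chrAt G x X Y) + chrAt G x (chrAt G x X Y) (K x))) Z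
        = G x (riemAt G x X (K x) Y) Z :=
    hA3 (fun X Y Z W => G x (riemAt G x X Y Z) W)
      (fun X Y Z => G x (fderiv ℝ (fun y => fderiv ℝ K y Y + chrAt G y Y (K y)) x X
          + chrAt G x X (fderiv ℝ K x Y + chrAt G x Y (K x))
          - (fderiv ℝ K x (chrAt G x X Y) + chrAt G x (chrAt G x X Y) (K x))) Z)
      (K x)
      (fun X Y Z W => killingProlongationOf_apply_riemAt_swap₁₂ G x X Y Z W)
      (fun X Y Z W => hG.apply_riemAt_swap hx X Y Z W)
      (fun X Y Z W => hG.apply_riemAt_cyclic hx X Y Z W)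
      (fun X Y Z W => hG.apply_riemAt_pair_comm hx X Y Z W)
      (fun X Y Z => by linarith [hA1 G V K hG hK hKil x hx X Y Z])
      (fun X Y Z => hA2 G V K hG hK x hx X Y Z)
  -- strip the test vector `Z` by nondegeneracy of `G x`
  have hvec : fderiv ℝ (fun y => fderiv ℝ K y Y + chrAt G y Y (K y)) x X
        + chrAt G x X (fderiv ℝ K x Y + chrAt G x Y (K x))
        - (fderiv ℝ K x (chrAt G x X Y) + chrAt G x (chrAt G x X Y) (K x))
      = riemAt G x X (K x) Y :=
    killingProlongationOf_eq_of_forall_apply (hG.isInvertible x hx) (key X Y)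
  rw [← hvec]
  abel

end Summit.FinalStateConjecture.FinalStateConjecture.Theorems

end
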